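import Summits.QuantumFields.BalabanUV.Beta.GAN24.T2RecOfUnitSplit
import Summits.QuantumFields.BalabanUV.Beta.GAN24.LinT2CoDressedStep
import Summits.QuantumFields.BalabanUV.Beta.GAN24.Lin4ZeroMode
import Summits.QuantumFields.BalabanUV.Beta.GAN24.T2SlotCovariance
import Summits.QuantumFields.BalabanUV.Beta.GAN24.WilsonQuarticCharge
import Summits.QuantumFields.BalabanUV.Beta.MixedJetTablesPlug

/-!
# `BalabanUV.Beta.GAN24.T2RecChargeStep` — binder row G-an2-4 ∕ (CONV-C), CT-W (F2): **THE EXACT ONE-STEP LAW OF THE FIELD–FIELD ZERO-MODE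
# CHARGE ALONG an2's DRESSED COMB TOWER `T̃_j = unitS₂_j (T2RecAt d Lc ρ …)`** — the dressed twin of leaf-18's `ChargeStepSym.zmode_succ_eq`:
# the linear part reads the charge of the LEG-DRESSED table `𝔇 T̃_j` (leaf-06's `lin4_comb_coDressKBmAt`), and the B-tower's source
# `σ_j := T̃_{j+1} − 𝒜^B_j T̃_j` is bond-symmetrised zero-mode-free iff the dressed tower obeys road W3's charge law at level `j`

NOT IN PRINT; OUR BOOKKEEPING (road-P2 chair of row G-an2-4, unit `b2b-balaban-gan24-p2` gen 36, crux team (2); journal INTENT [GAN24P2-G36-INTENT1];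
the Lean face of leaf-02 g52's located reading F-leaf02-g52-1 (ii) «what survives is the JOINT zero mode ⟺ the dressed tower conserves its ff charge»).
HONEST FRAMING (cell contract, verbatim): «discharging `BetaPertH` makes Bałaban's UV stability UNCONDITIONAL — a real constructive-QFT result; it is
NOT the continuum limit and NOT the Clay problem.»  HONEST DEPENDENCY (verbatim): «continuum YM on T⁴ ⇐ BetaPertH ∧ nine spine estimates (0/9 proved);
BetaPertH ⇐ (D1) ∧ (D4) ∧ CAP+tail; G-an2-4 gates asym, D1 and NE2/3/4.»

NOTATION (docstrings only).  `T̃_j := unitS₂ (sfStep Lc j) (smStep d Lc j) (T2RecAt d Lc (toSite r) cE cVH cΛ cE₂ cB Tc vh₂S (mixFFAt (toSite r) Lc) j)`,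
`G̃_j := unitK_j (coDressKBmAt (toSite r) Lc (KInvStep Lc j))`, `K♮_j := unitK_j (KInvStep Lc j)`, `c := cE₂·Lc^{2(d+1)}`, `𝒜^E_j := lin4 c G̃_j Lc`,
`𝒜^B_j := lin4 c K♮_j Lc` (road W3's transport of record), `b̃_j := c • mmRead Lc ∘ K3OfK G̃_j Lc S̃_j M̃_j (W2SymOfK G̃_j Lc S̃_j M̃_j 0 M̃₂_j) + cB • vh₂S`
(the `T̃`-free part of the dressed step, `T2RecOfUnitSplit`), `𝔇 X := dressKBmAt ρ Lc (coProjBmAtK ρ Lc (fun κ₁ u₁ ↦ coProjBmAtK ρ Lc (X κ₁ u₁) κ′ u′) κ u)`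
(leaf-06's leg-and-slot dressing, the lambda of `lin4_comb_coDressKBmAt` VERBATIM), `σ_j := T̃_{j+1} − 𝒜^B_j T̃_j` (the B-tower's level-`j` source
= `b̃_j + cell_j`, leaf-01 g62's `T2HybridCellsComb.cell_comb_eq`).

WHAT (generic `d`, in-block root `r ∈ box (d+1) Lc`, every `j`, every period `N`, ALL constants `cE cVH cΛ cE₂ cB` symbolic, NO pin; a generic
OFF-DIAGONAL jointly `Lc`-covariant `LocStencil₂` border `vh₂S`; [folklore] composition BY NAME; 0 `def`, 0 cite, 0 `def … : Prop`, 0 sorry):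
* §1 `succ_eq_lin4_dress_add` — the dressed affine step with the dressing moved onto the table: `T̃_{j+1} = 𝒜^B_j (𝔇 T̃_j) + b̃_j`
  (`T2RecOfUnitSplit.unitS₂_T2RecOf_succ_eq_lin4_add` at the comb data ∘ `LinT2CoDressedStep.lin4_comb_coDressKBmAt`).
* §2 **`zmode_succ_eq`** — THE ONE-STEP CHARGE LAW, cell form at any period `N`:
  `zmode N T̃_{j+1} (μ,ν;α,β) = zmode N b̃_j (μ,ν;α,β) + N^{d+1}·c·½·Lc^{−4(d+2)}·(zmode Lc (𝔇 T̃_j) (μ,ν;α,β) + zmode Lc (𝔇 T̃_j) (ν,μ;α,β))`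
  (`Lin4ZeroMode.zmode_lin4_step` on the dressed table — `LocStencil₂` by `locStencil₂_dress ∘ _coProj_fst ∘ _coProj_snd`, jointly covariant by
  `translate_dress`); **`zmode_succ_antisymm`** — the bond-antisymmetric charge of `T̃_{j+1}` is the source's alone (pin-free, as in road W3).
* §3 **`zmodeSym_sourceB_eq`** — THE CONSERVATION CRITERION: `zmode N σ_j (μν) + zmode N σ_j (νμ) = [zmode N T̃_{j+1} (μν) + (νμ)] −
  N^{d+1}·c·Lc^{−4(d+2)}·[zmode Lc T̃_j (μν) + (νμ)]` and **`zfreeSym_sourceB_iff`** — «the B-tower's level-`j` source is bond-symmetrised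
  zero-mode-free iff the dressed tower obeys road W3's charge law `zmodeSym_N (T̃_{j+1}) = N^{d+1}·c·Lc^{−4(d+2)}·zmodeSym_Lc (T̃_j)` at level `j`»
  (at `N = Lc`, `d = 3`, pin `cE₂ = Lc⁸` the factor is `1`: charge conservation).
* §4 member `0`: `member_zero_inl_inl`, **`zmode_member_zero`** — `zmode N T̃₀ (μ,ν;α,β) = cE₂·N^{d+1}·Z₄(Tc)(μ,ν;α,β)` (leaf-18's
  `WilsonQuarticCharge.tsum_wilsonW₂_ff_eq`; the border's ff block is `0`).
READING (docstring level; NOT asserted): with leaf-02 g52's `zmode_Lc (𝔇 Y) = Lc⁴·fourFace_Lc (Y)` (`TableDressingZeroMode`) §2's dressed term is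
the FOUR-FACE charge; at member `0` (ultra-local Wilson table) it is `Lc²·zmode` on the charged patterns, so conservation at step `0` forces
`zmodeSym (b̃₀) = (1 − Lc²)·λ₀·zmodeSym (T̃₀)`.  OF RECORD (the OWNER gan24-p1 g23's D = 2 numerics R-gan24p1-g23-1∕-3∕-4, Lc = 3): `Z(b̃₀) = −8·Z(𝒜^B₀T̃₀)`
(= `1 − Lc²`), `Z(T̃₁) = Z(T₁)` and `Z(T̃₂) = Z(T₂)` (conservation (C_1), (C_2) exact), `Z(𝒜^E_1 T̃_1)∕Z(T̃_1) = 1713.96 = 81·81·(FF∕Z)(T̃_1)` — so the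
criterion of §3 holds on the orbit at j = 0, 1 numerically; (F2) as first posed («`ZfreeSym (b̃_m)`») is false (R1) and the `ZfreeSym`-type correction rows
are withdrawn (RULING R-gan24p1-g23-3); (C) ∀ j as a theorem is OPEN (first refusal an2).  Asserts NO value of Bałaban's tables beyond the tree's `Z₄`;
discharges NOTHING of (C), «T2Shape», «T2Drift», (hW, hWall); NEVER «G-an2-4 closed» as (CONV-C); NOT D1, NOT BetaPertH, NOT continuum, NOT Clay.  2026-08-22.
-/

noncomputable section

open Finset
open scoped BigOperators
open Literature.MathematicalPhysics.QuantumFieldTheory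
open Literature.MathematicalPhysics.QuantumFieldTheory.Balaban1983to89
open Literature.MathematicalPhysics.QuantumFieldTheory.Balaban1983to89.Beta
open ExpKernelCalculus (MKer Decays shiftK)
open OneStepResolventKernel (Fib decays_mono)
open OneStepKernelFamily (KInvStep decays_KInvStep)
open AffineAveraging (box toSite)
open BalabanCompositeJets (LocStencil₂)
open SecondOrderResponse (W2SymOfK LocStencilFM)
open BalabanStepJetsSucc (mmRead)
open BalabanStepW2 (K3OfK M2Of)
open WilsonBiStencil (wilsonW₂)
open AveragingMixedJetTables (mixFFAt)
open Summit.QuantumFields.BalabanUV.Beta.HessKerDressedUnits (unitK unitS decays_unitK legScale_inl)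
open Summit.QuantumFields.BalabanUV.Beta.SecondOrderUnits (unitM unitS₂ unitM₂)
open Summit.QuantumFields.BalabanUV.Beta.AxialDressingRooted (coProjBmAtK coDressKBmAt dressKBmAt decays_coDressKBmAt_KInvStep)
open Summit.QuantumFields.BalabanUV.Beta.SpineRooted (T2RecOf T2RecAt SpureRecAt M1At T2RecOf_comb T2RecAt_loc T2RecAt_translate T2RecAt_zero_level
  locStencil_SpureRecAt vertexFamily_M1At)
open Summit.QuantumFields.BalabanUV.Beta.MixedJetTablesPlug (hmix_an1 hmixt_an1)
open Summit.QuantumFields.BalabanUV.Beta.GAN24.CombesThomas (sfStep smStep)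
open Summit.QuantumFields.BalabanUV.Beta.GAN24.T2SlotUnits (unitS₂_apply)
open Summit.QuantumFields.BalabanUV.Beta.GAN24.T2SlotCovariance (unitS₂_translate)
open Summit.QuantumFields.BalabanUV.Beta.GAN24.T2RecursionAffine (lin4)
open Summit.QuantumFields.BalabanUV.Beta.GAN24.BiStencilZeroMode (Tab zmode)
open Summit.QuantumFields.BalabanUV.Beta.GAN24.TransversalZeroMode (card_box_succ)
open Summit.QuantumFields.BalabanUV.Beta.GAN24.WSlotFirstDiff (locStencil₂_unitS₂ zmode_add zmode_sub)
open Summit.QuantumFields.BalabanUV.Beta.GAN24.Lin4ZeroMode (locStencil₂_lin4 zmode_lin4_step)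
open Summit.QuantumFields.BalabanUV.Beta.GAN24.LinT2CoDressed (locStencil₂_coProj_snd locStencil₂_coProj_fst locStencil₂_dress)
open Summit.QuantumFields.BalabanUV.Beta.GAN24.LinT2CoDressedStep (lin4_comb_coDressKBmAt translate_dress)
open Summit.QuantumFields.BalabanUV.Beta.GAN24.T2RecOfUnitSplit (unitS₂_T2RecOf_succ_eq_lin4_add step_data_of_letters)
open Summit.QuantumFields.BalabanUV.Beta.GAN24.WilsonQuarticCharge (tsum_wilsonW₂_ff_eq)

namespace Summit.QuantumFields.BalabanUV.Beta.GAN24.T2RecChargeStep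

variable {d : ℕ} {Lc : ℕ} [NeZero Lc] {r : Fin (d + 1) → ℕ}

/-! ## §0 The per-level shape and covariance of the normalised comb member -/

/-- [folklore] **EVERY NORMALISED COMB MEMBER IS `LocStencil₂`** (an2's `T2RecAt_loc` + leaf-04's `locStencil₂_unitS₂`; existential constants). -/
theorem shape_member (hLc : 1 ≤ Lc) (hr : r ∈ box (d + 1) Lc) (cE cVH cΛ cE₂ cB : ℝ) (Tc : Fin 4 → Fin 4 → Fin 4 → Fin 4 → ℝ)
    {vh₂S : Tab d} (hB : ∃ C δ : ℝ, 0 < δ ∧ LocStencil₂ vh₂S C δ) (j : ℕ) :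
    ∃ CT δT : ℝ, 0 < δT ∧ LocStencil₂ (unitS₂ (sfStep Lc j) (smStep d Lc j)
      (T2RecAt d Lc (toSite r) cE cVH cΛ cE₂ cB Tc vh₂S (mixFFAt (toSite r) Lc) j)) CT δT := by
  obtain ⟨C, δ, hδ, h⟩ := T2RecAt_loc cE cVH cΛ cE₂ cB Tc vh₂S (mixFFAt (toSite r) Lc) hLc hr hB (hmix_an1 hLc hr) j
  exact ⟨_, δ, hδ, locStencil₂_unitS₂ (sfStep Lc j) (smStep d Lc j) h⟩

/-- [folklore] **EVERY NORMALISED COMB MEMBER IS JOINTLY `Lc`-COVARIANT** (an2's `T2RecAt_translate` over an1's `mixFFAt` covariance `hmixt_an1` and the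
border's `hBt`; leaf-19's `unitS₂_translate`). -/
theorem member_translate (hLc : 1 ≤ Lc) (cE cVH cΛ cE₂ cB : ℝ) (Tc : Fin 4 → Fin 4 → Fin 4 → Fin 4 → ℝ) {vh₂S : Tab d}
    (hBt : ∀ (κ : Fin (d + 1)) (u : Fin (d + 1) → ℤ) (κ' : Fin (d + 1)) (u' t : Fin (d + 1) → ℤ),
      vh₂S κ (u + (Lc : ℤ) • t) κ' (u' + (Lc : ℤ) • t) = shiftK (-((Lc : ℤ) • t)) (vh₂S κ u κ' u')) (j : ℕ)
    (κ : Fin (d + 1)) (u : Fin (d + 1) → ℤ) (κ' : Fin (d + 1)) (u' t : Fin (d + 1) → ℤ) :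
    unitS₂ (sfStep Lc j) (smStep d Lc j) (T2RecAt d Lc (toSite r) cE cVH cΛ cE₂ cB Tc vh₂S (mixFFAt (toSite r) Lc) j) κ (u + (Lc : ℤ) • t) κ'
        (u' + (Lc : ℤ) • t)
      = shiftK (-((Lc : ℤ) • t)) (unitS₂ (sfStep Lc j) (smStep d Lc j)
          (T2RecAt d Lc (toSite r) cE cVH cΛ cE₂ cB Tc vh₂S (mixFFAt (toSite r) Lc) j) κ u κ' u') :=
  unitS₂_translate (w := (Lc : ℤ) • t) (v := -((Lc : ℤ) • t)) (sfStep Lc j) (smStep d Lc j)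
    (fun κ u κ' u' => T2RecAt_translate (toSite r) cE cVH cΛ cE₂ cB Tc vh₂S (mixFFAt (toSite r) Lc) hLc hBt (hmixt_an1 (toSite r)) j κ u κ' u' t)
    κ u κ' u'

omit [NeZero Lc] in
/-- [folklore] **THE LEG-DRESSED TABLE OF A `LocStencil₂` TABLE IS `LocStencil₂` AT THE SAME RATE** (leaf-06's `locStencil₂_coProj_snd`, `_coProj_fst`,
`locStencil₂_dress`; constant existential). -/
theorem shape_dress (hLc : 1 ≤ Lc) (hr : r ∈ box (d + 1) Lc) {X : Tab d} {C δ : ℝ} (hX : LocStencil₂ X C δ) (hδ : 0 ≤ δ) :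
    ∃ C' : ℝ, LocStencil₂ (fun κ u κ' u' => dressKBmAt (toSite r) Lc
      (coProjBmAtK (toSite r) Lc (fun κ₁ u₁ => coProjBmAtK (toSite r) Lc (X κ₁ u₁) κ' u') κ u)) C' δ :=
  ⟨_, locStencil₂_dress hLc hr (locStencil₂_coProj_fst hLc hr (locStencil₂_coProj_snd hLc hr hX hδ) hδ) hδ⟩

/-! ## §1 The dressed affine step with the dressing on the table -/

/-- NOT IN PRINT; OUR BOOKKEEPING.  **THE DRESSED AFFINE STEP, DRESSING MOVED ONTO THE TABLE**: for every `j`,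
`T̃_{j+1} = 𝒜^B_j (𝔇 T̃_j) + b̃_j` — my (F1) affine step `T2RecOfUnitSplit.unitS₂_T2RecOf_succ_eq_lin4_add` at the comb data (letters: asym1's
`decays_coDressKBmAt_KInvStep`, an2's `locStencil_SpureRecAt` ∕ `vertexFamily_M1At`, an1's `hmix_an1`; bridge `T2RecOf_comb`) followed by leaf-06's
`lin4_comb_coDressKBmAt` (`𝒜^E_j Y = 𝒜^B_j (𝔇 Y)`). -/
theorem succ_eq_lin4_dress_add (hLc : 1 ≤ Lc) (hr : r ∈ box (d + 1) Lc) (cE cVH cΛ cE₂ cB : ℝ) (Tc : Fin 4 → Fin 4 → Fin 4 → Fin 4 → ℝ)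
    {vh₂S : Tab d} (hBff : ∀ κ u κ' u' x z (α β : Fin (d + 1)), vh₂S κ u κ' u' x z (Sum.inl α) (Sum.inl β) = 0)
    (hBmm : ∀ κ u κ' u' x z (μ ν : Fin (d + 1)), vh₂S κ u κ' u' x z (Sum.inr μ) (Sum.inr ν) = 0)
    (hB : ∃ C δ : ℝ, 0 < δ ∧ LocStencil₂ vh₂S C δ) (j : ℕ) :
    unitS₂ (sfStep Lc (j + 1)) (smStep d Lc (j + 1)) (T2RecAt d Lc (toSite r) cE cVH cΛ cE₂ cB Tc vh₂S (mixFFAt (toSite r) Lc) (j + 1))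
      = lin4 (cE₂ * (Lc : ℝ) ^ (2 * (d + 1))) (unitK (sfStep Lc j) (smStep d Lc j) (KInvStep (d := d) Lc j)) Lc
          (fun κ u κ' u' => dressKBmAt (toSite r) Lc (coProjBmAtK (toSite r) Lc (fun κ₁ u₁ => coProjBmAtK (toSite r) Lc
            (unitS₂ (sfStep Lc j) (smStep d Lc j) (T2RecAt d Lc (toSite r) cE cVH cΛ cE₂ cB Tc vh₂S (mixFFAt (toSite r) Lc) j) κ₁ u₁) κ' u') κ u))
        + (fun κ u κ' u' => (cE₂ * (Lc : ℝ) ^ (2 * (d + 1))) • mmRead Lc (K3OfK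
            (unitK (sfStep Lc j) (smStep d Lc j) (coDressKBmAt (toSite r) Lc (KInvStep (d := d) Lc j))) Lc
            (unitS (sfStep Lc j) (smStep d Lc j) (SpureRecAt d Lc (toSite r) cE cVH cΛ j)) (unitM (sfStep Lc j) (smStep d Lc j) (M1At d Lc (toSite r) cΛ j))
            (W2SymOfK (unitK (sfStep Lc j) (smStep d Lc j) (coDressKBmAt (toSite r) Lc (KInvStep (d := d) Lc j))) Lc
              (unitS (sfStep Lc j) (smStep d Lc j) (SpureRecAt d Lc (toSite r) cE cVH cΛ j)) (unitM (sfStep Lc j) (smStep d Lc j) (M1At d Lc (toSite r) cΛ j)) 0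
              (unitM₂ (sfStep Lc j) (smStep d Lc j) (M2Of d Lc (mixFFAt (toSite r) Lc) j))) κ u κ' u') + cB • vh₂S κ u κ' u') := by
  obtain ⟨C, δ, C₀, C₁, hδ, hK, h₀, hW⟩ := step_data_of_letters (fun j => coDressKBmAt (toSite r) Lc (KInvStep (d := d) Lc j))
      (SpureRecAt d Lc (toSite r) cE cVH cΛ) (M1At d Lc (toSite r) cΛ) cE₂ cB Tc hLc
      (fun j => decays_coDressKBmAt_KInvStep (d := d) hr j) (fun j => locStencil_SpureRecAt hLc hr cE cVH cΛ j)
      (fun j => ⟨_, 1, one_pos, vertexFamily_M1At hLc hr cΛ j zero_le_one⟩) hB (hmix_an1 hLc hr) j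
  have hstep := unitS₂_T2RecOf_succ_eq_lin4_add (fun j => coDressKBmAt (toSite r) Lc (KInvStep (d := d) Lc j))
      (SpureRecAt d Lc (toSite r) cE cVH cΛ) (M1At d Lc (toSite r) cΛ) cE₂ cB Tc vh₂S (mixFFAt (toSite r) Lc) hBff hBmm j hδ hK h₀ hW
  simp only [T2RecOf_comb] at hstep
  obtain ⟨CT, δT, hδT, hT⟩ := shape_member hLc hr cE cVH cΛ cE₂ cB Tc hB j
  rw [hstep, lin4_comb_coDressKBmAt hr j hT hδT]

/-! ## §2 THE ONE-STEP CHARGE LAW: the linear part reads the charge of the dressed table -/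

/-- NOT IN PRINT; OUR BOOKKEEPING ([folklore] composition).  **THE ONE-STEP CHARGE LAW OF THE DRESSED COMB TOWER**, cell form at any period `N`:
`zmode N T̃_{j+1} (μ,ν;α,β) = zmode N b̃_j (μ,ν;α,β) + N^{d+1}·(cE₂·Lc^{2(d+1)})·½·Lc^{−4(d+2)}·(zmode Lc (𝔇 T̃_j) (μ,ν;α,β) + zmode Lc (𝔇 T̃_j) (ν,μ;α,β))`
— EXACTLY leaf-18's `ChargeStepSym.zmode_succ_eq` for road W3's undressed tower with the input charge read on the LEG-DRESSED table `𝔇 T̃_j`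
(§1 + `Lin4ZeroMode.zmode_lin4_step`, the dressed table being `LocStencil₂` (`shape_dress`) and jointly `Lc`-covariant (`translate_dress`);
`zmode_sub` for the source `b̃_j = T̃_{j+1} − 𝒜^B_j (𝔇 T̃_j)`).  Every `j`, generic `d`, all constants symbolic, NO pin. -/
theorem zmode_succ_eq (hLc : 1 ≤ Lc) (hr : r ∈ box (d + 1) Lc) (cE cVH cΛ cE₂ cB : ℝ) (Tc : Fin 4 → Fin 4 → Fin 4 → Fin 4 → ℝ)
    {vh₂S : Tab d} (hBff : ∀ κ u κ' u' x z (α β : Fin (d + 1)), vh₂S κ u κ' u' x z (Sum.inl α) (Sum.inl β) = 0)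
    (hBmm : ∀ κ u κ' u' x z (μ ν : Fin (d + 1)), vh₂S κ u κ' u' x z (Sum.inr μ) (Sum.inr ν) = 0)
    (hB : ∃ C δ : ℝ, 0 < δ ∧ LocStencil₂ vh₂S C δ)
    (hBt : ∀ (κ : Fin (d + 1)) (u : Fin (d + 1) → ℤ) (κ' : Fin (d + 1)) (u' t : Fin (d + 1) → ℤ),
      vh₂S κ (u + (Lc : ℤ) • t) κ' (u' + (Lc : ℤ) • t) = shiftK (-((Lc : ℤ) • t)) (vh₂S κ u κ' u'))
    (N j : ℕ) (μ ν α β : Fin (d + 1)) :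
    zmode N (unitS₂ (sfStep Lc (j + 1)) (smStep d Lc (j + 1)) (T2RecAt d Lc (toSite r) cE cVH cΛ cE₂ cB Tc vh₂S (mixFFAt (toSite r) Lc) (j + 1)))
        μ ν (Sum.inl α) (Sum.inl β)
      = zmode N (fun κ u κ' u' => (cE₂ * (Lc : ℝ) ^ (2 * (d + 1))) • mmRead Lc (K3OfK
            (unitK (sfStep Lc j) (smStep d Lc j) (coDressKBmAt (toSite r) Lc (KInvStep (d := d) Lc j))) Lc
            (unitS (sfStep Lc j) (smStep d Lc j) (SpureRecAt d Lc (toSite r) cE cVH cΛ j)) (unitM (sfStep Lc j) (smStep d Lc j) (M1At d Lc (toSite r) cΛ j))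
            (W2SymOfK (unitK (sfStep Lc j) (smStep d Lc j) (coDressKBmAt (toSite r) Lc (KInvStep (d := d) Lc j))) Lc
              (unitS (sfStep Lc j) (smStep d Lc j) (SpureRecAt d Lc (toSite r) cE cVH cΛ j)) (unitM (sfStep Lc j) (smStep d Lc j) (M1At d Lc (toSite r) cΛ j)) 0
              (unitM₂ (sfStep Lc j) (smStep d Lc j) (M2Of d Lc (mixFFAt (toSite r) Lc) j))) κ u κ' u') + cB • vh₂S κ u κ' u')
          μ ν (Sum.inl α) (Sum.inl β)
        + ((N : ℝ) ^ (d + 1)) * ((cE₂ * (Lc : ℝ) ^ (2 * (d + 1))) * ((1 / 2 : ℝ) * (((Lc : ℝ) ^ (d + 1 + 1))⁻¹) ^ 4) *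
          (zmode Lc (fun κ u κ' u' => dressKBmAt (toSite r) Lc (coProjBmAtK (toSite r) Lc (fun κ₁ u₁ => coProjBmAtK (toSite r) Lc
              (unitS₂ (sfStep Lc j) (smStep d Lc j) (T2RecAt d Lc (toSite r) cE cVH cΛ cE₂ cB Tc vh₂S (mixFFAt (toSite r) Lc) j) κ₁ u₁) κ' u') κ u))
              μ ν (Sum.inl α) (Sum.inl β)
            + zmode Lc (fun κ u κ' u' => dressKBmAt (toSite r) Lc (coProjBmAtK (toSite r) Lc (fun κ₁ u₁ => coProjBmAtK (toSite r) Lc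
              (unitS₂ (sfStep Lc j) (smStep d Lc j) (T2RecAt d Lc (toSite r) cE cVH cΛ cE₂ cB Tc vh₂S (mixFFAt (toSite r) Lc) j) κ₁ u₁) κ' u') κ u))
              ν μ (Sum.inl α) (Sum.inl β))) := by
  -- the dressed step and the shapes
  have hstep := succ_eq_lin4_dress_add hLc hr cE cVH cΛ cE₂ cB Tc hBff hBmm hB j
  obtain ⟨CT, δT, hδT, hT⟩ := shape_member hLc hr cE cVH cΛ cE₂ cB Tc hB j
  obtain ⟨C1, δ1, hδ1, hT1⟩ := shape_member hLc hr cE cVH cΛ cE₂ cB Tc hB (j + 1)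
  have hTcov := member_translate (r := r) hLc cE cVH cΛ cE₂ cB Tc hBt j
  obtain ⟨CD, hD⟩ := shape_dress hLc hr hT hδT.le
  have hDcov := translate_dress (toSite r) hLc hTcov
  obtain ⟨m, CK, hm, hCK, hK⟩ := decays_KInvStep (d := d) (Lc := Lc) j
  have hA := locStencil₂_lin4 (decays_unitK (sf := sfStep Lc j) (sm := smStep d Lc j) hK) (by positivity) hm hLc
    (cE₂ * (Lc : ℝ) ^ (2 * (d + 1))) hD hδT
  -- the charge of the linear image of the dressed table
  have hz := zmode_lin4_step hLc N j (cE₂ * (Lc : ℝ) ^ (2 * (d + 1))) hD hδT hDcov μ ν α β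
  -- the source is the member minus the linear image
  have hb : (fun κ u κ' u' => (cE₂ * (Lc : ℝ) ^ (2 * (d + 1))) • mmRead Lc (K3OfK
            (unitK (sfStep Lc j) (smStep d Lc j) (coDressKBmAt (toSite r) Lc (KInvStep (d := d) Lc j))) Lc
            (unitS (sfStep Lc j) (smStep d Lc j) (SpureRecAt d Lc (toSite r) cE cVH cΛ j)) (unitM (sfStep Lc j) (smStep d Lc j) (M1At d Lc (toSite r) cΛ j))
            (W2SymOfK (unitK (sfStep Lc j) (smStep d Lc j) (coDressKBmAt (toSite r) Lc (KInvStep (d := d) Lc j))) Lc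
              (unitS (sfStep Lc j) (smStep d Lc j) (SpureRecAt d Lc (toSite r) cE cVH cΛ j)) (unitM (sfStep Lc j) (smStep d Lc j) (M1At d Lc (toSite r) cΛ j)) 0
              (unitM₂ (sfStep Lc j) (smStep d Lc j) (M2Of d Lc (mixFFAt (toSite r) Lc) j))) κ u κ' u') + cB • vh₂S κ u κ' u')
      = fun κ u κ' u' =>
          unitS₂ (sfStep Lc (j + 1)) (smStep d Lc (j + 1)) (T2RecAt d Lc (toSite r) cE cVH cΛ cE₂ cB Tc vh₂S (mixFFAt (toSite r) Lc) (j + 1)) κ u κ' u'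
        - lin4 (cE₂ * (Lc : ℝ) ^ (2 * (d + 1))) (unitK (sfStep Lc j) (smStep d Lc j) (KInvStep (d := d) Lc j)) Lc
            (fun κ u κ' u' => dressKBmAt (toSite r) Lc (coProjBmAtK (toSite r) Lc (fun κ₁ u₁ => coProjBmAtK (toSite r) Lc
              (unitS₂ (sfStep Lc j) (smStep d Lc j) (T2RecAt d Lc (toSite r) cE cVH cΛ cE₂ cB Tc vh₂S (mixFFAt (toSite r) Lc) j) κ₁ u₁) κ' u') κ u))
            κ u κ' u' := by
    rw [hstep]
    funext κ u κ' u'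
    simp only [Pi.add_apply, add_sub_cancel_left]
  have hr0 : 0 < min δ1 (min m δT / 128) := lt_min hδ1 (by positivity)
  rw [hb, zmode_sub (N := N) (hT1.mono (min_le_left _ _)) (hA.mono (min_le_right _ _)) hr0, hz]
  ring

/-- NOT IN PRINT; OUR BOOKKEEPING.  **THE BOND-ANTISYMMETRIC CHARGE IS THE SOURCE's ALONE** ([folklore]; the transported term of §2 is bond-symmetrised):
`zmode N T̃_{j+1} (μ,ν) − zmode N T̃_{j+1} (ν,μ) = zmode N b̃_j (μ,ν) − zmode N b̃_j (ν,μ)` — whatever `cE₂`, NO pin (road W3's `zmode_succ_antisymm`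
for the dressed tower). -/
theorem zmode_succ_antisymm (hLc : 1 ≤ Lc) (hr : r ∈ box (d + 1) Lc) (cE cVH cΛ cE₂ cB : ℝ) (Tc : Fin 4 → Fin 4 → Fin 4 → Fin 4 → ℝ)
    {vh₂S : Tab d} (hBff : ∀ κ u κ' u' x z (α β : Fin (d + 1)), vh₂S κ u κ' u' x z (Sum.inl α) (Sum.inl β) = 0)
    (hBmm : ∀ κ u κ' u' x z (μ ν : Fin (d + 1)), vh₂S κ u κ' u' x z (Sum.inr μ) (Sum.inr ν) = 0)
    (hB : ∃ C δ : ℝ, 0 < δ ∧ LocStencil₂ vh₂S C δ)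
    (hBt : ∀ (κ : Fin (d + 1)) (u : Fin (d + 1) → ℤ) (κ' : Fin (d + 1)) (u' t : Fin (d + 1) → ℤ),
      vh₂S κ (u + (Lc : ℤ) • t) κ' (u' + (Lc : ℤ) • t) = shiftK (-((Lc : ℤ) • t)) (vh₂S κ u κ' u'))
    (N j : ℕ) (μ ν α β : Fin (d + 1)) :
    zmode N (unitS₂ (sfStep Lc (j + 1)) (smStep d Lc (j + 1)) (T2RecAt d Lc (toSite r) cE cVH cΛ cE₂ cB Tc vh₂S (mixFFAt (toSite r) Lc) (j + 1)))
          μ ν (Sum.inl α) (Sum.inl β)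
        - zmode N (unitS₂ (sfStep Lc (j + 1)) (smStep d Lc (j + 1)) (T2RecAt d Lc (toSite r) cE cVH cΛ cE₂ cB Tc vh₂S (mixFFAt (toSite r) Lc) (j + 1)))
          ν μ (Sum.inl α) (Sum.inl β)
      = zmode N (fun κ u κ' u' => (cE₂ * (Lc : ℝ) ^ (2 * (d + 1))) • mmRead Lc (K3OfK
            (unitK (sfStep Lc j) (smStep d Lc j) (coDressKBmAt (toSite r) Lc (KInvStep (d := d) Lc j))) Lc
            (unitS (sfStep Lc j) (smStep d Lc j) (SpureRecAt d Lc (toSite r) cE cVH cΛ j)) (unitM (sfStep Lc j) (smStep d Lc j) (M1At d Lc (toSite r) cΛ j))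
            (W2SymOfK (unitK (sfStep Lc j) (smStep d Lc j) (coDressKBmAt (toSite r) Lc (KInvStep (d := d) Lc j))) Lc
              (unitS (sfStep Lc j) (smStep d Lc j) (SpureRecAt d Lc (toSite r) cE cVH cΛ j)) (unitM (sfStep Lc j) (smStep d Lc j) (M1At d Lc (toSite r) cΛ j)) 0
              (unitM₂ (sfStep Lc j) (smStep d Lc j) (M2Of d Lc (mixFFAt (toSite r) Lc) j))) κ u κ' u') + cB • vh₂S κ u κ' u')
          μ ν (Sum.inl α) (Sum.inl β)
        - zmode N (fun κ u κ' u' => (cE₂ * (Lc : ℝ) ^ (2 * (d + 1))) • mmRead Lc (K3OfK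
            (unitK (sfStep Lc j) (smStep d Lc j) (coDressKBmAt (toSite r) Lc (KInvStep (d := d) Lc j))) Lc
            (unitS (sfStep Lc j) (smStep d Lc j) (SpureRecAt d Lc (toSite r) cE cVH cΛ j)) (unitM (sfStep Lc j) (smStep d Lc j) (M1At d Lc (toSite r) cΛ j))
            (W2SymOfK (unitK (sfStep Lc j) (smStep d Lc j) (coDressKBmAt (toSite r) Lc (KInvStep (d := d) Lc j))) Lc
              (unitS (sfStep Lc j) (smStep d Lc j) (SpureRecAt d Lc (toSite r) cE cVH cΛ j)) (unitM (sfStep Lc j) (smStep d Lc j) (M1At d Lc (toSite r) cΛ j)) 0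
              (unitM₂ (sfStep Lc j) (smStep d Lc j) (M2Of d Lc (mixFFAt (toSite r) Lc) j))) κ u κ' u') + cB • vh₂S κ u κ' u')
          ν μ (Sum.inl α) (Sum.inl β) := by
  rw [zmode_succ_eq hLc hr cE cVH cΛ cE₂ cB Tc hBff hBmm hB hBt N j μ ν α β, zmode_succ_eq hLc hr cE cVH cΛ cE₂ cB Tc hBff hBmm hB hBt N j ν μ α β]
  ring

/-! ## §3 THE CONSERVATION CRITERION: the B-tower's source `σ_j = T̃_{j+1} − 𝒜^B_j T̃_j` -/

/-- NOT IN PRINT; OUR BOOKKEEPING ([folklore]; `zmode_sub` + `zmode_lin4_step` on the UNDRESSED linear image of the member).  **THE BOND-SYMMETRISED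
CHARGE OF THE B-TOWER's LEVEL-`j` SOURCE** `σ_j := T̃_{j+1} − 𝒜^B_j T̃_j` (`= b̃_j + cell_j`, leaf-01 g62's `cell_comb_eq`; the sources road W3's END
transports in the (B-above) hybrid form):
`zmode N σ_j (μν) + zmode N σ_j (νμ) = [zmode N T̃_{j+1} (μν) + zmode N T̃_{j+1} (νμ)] − N^{d+1}·(cE₂·Lc^{2(d+1)})·Lc^{−4(d+2)}·[zmode Lc T̃_j (μν) + zmode Lc T̃_j (νμ)]`.
Every `j`, every `N`, generic `d`, NO pin. -/
theorem zmodeSym_sourceB_eq (hLc : 1 ≤ Lc) (hr : r ∈ box (d + 1) Lc) (cE cVH cΛ cE₂ cB : ℝ) (Tc : Fin 4 → Fin 4 → Fin 4 → Fin 4 → ℝ)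
    {vh₂S : Tab d} (hB : ∃ C δ : ℝ, 0 < δ ∧ LocStencil₂ vh₂S C δ)
    (hBt : ∀ (κ : Fin (d + 1)) (u : Fin (d + 1) → ℤ) (κ' : Fin (d + 1)) (u' t : Fin (d + 1) → ℤ),
      vh₂S κ (u + (Lc : ℤ) • t) κ' (u' + (Lc : ℤ) • t) = shiftK (-((Lc : ℤ) • t)) (vh₂S κ u κ' u'))
    (N j : ℕ) (μ ν α β : Fin (d + 1)) :
    zmode N (fun κ u κ' u' =>
          unitS₂ (sfStep Lc (j + 1)) (smStep d Lc (j + 1)) (T2RecAt d Lc (toSite r) cE cVH cΛ cE₂ cB Tc vh₂S (mixFFAt (toSite r) Lc) (j + 1)) κ u κ' u'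
        - lin4 (cE₂ * (Lc : ℝ) ^ (2 * (d + 1))) (unitK (sfStep Lc j) (smStep d Lc j) (KInvStep (d := d) Lc j)) Lc
            (unitS₂ (sfStep Lc j) (smStep d Lc j) (T2RecAt d Lc (toSite r) cE cVH cΛ cE₂ cB Tc vh₂S (mixFFAt (toSite r) Lc) j)) κ u κ' u')
          μ ν (Sum.inl α) (Sum.inl β)
      + zmode N (fun κ u κ' u' =>
          unitS₂ (sfStep Lc (j + 1)) (smStep d Lc (j + 1)) (T2RecAt d Lc (toSite r) cE cVH cΛ cE₂ cB Tc vh₂S (mixFFAt (toSite r) Lc) (j + 1)) κ u κ' u'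
        - lin4 (cE₂ * (Lc : ℝ) ^ (2 * (d + 1))) (unitK (sfStep Lc j) (smStep d Lc j) (KInvStep (d := d) Lc j)) Lc
            (unitS₂ (sfStep Lc j) (smStep d Lc j) (T2RecAt d Lc (toSite r) cE cVH cΛ cE₂ cB Tc vh₂S (mixFFAt (toSite r) Lc) j)) κ u κ' u')
          ν μ (Sum.inl α) (Sum.inl β)
      = (zmode N (unitS₂ (sfStep Lc (j + 1)) (smStep d Lc (j + 1)) (T2RecAt d Lc (toSite r) cE cVH cΛ cE₂ cB Tc vh₂S (mixFFAt (toSite r) Lc) (j + 1)))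
            μ ν (Sum.inl α) (Sum.inl β)
          + zmode N (unitS₂ (sfStep Lc (j + 1)) (smStep d Lc (j + 1)) (T2RecAt d Lc (toSite r) cE cVH cΛ cE₂ cB Tc vh₂S (mixFFAt (toSite r) Lc) (j + 1)))
            ν μ (Sum.inl α) (Sum.inl β))
        - ((N : ℝ) ^ (d + 1)) * ((cE₂ * (Lc : ℝ) ^ (2 * (d + 1))) * (((Lc : ℝ) ^ (d + 1 + 1))⁻¹) ^ 4) *
          (zmode Lc (unitS₂ (sfStep Lc j) (smStep d Lc j) (T2RecAt d Lc (toSite r) cE cVH cΛ cE₂ cB Tc vh₂S (mixFFAt (toSite r) Lc) j))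
              μ ν (Sum.inl α) (Sum.inl β)
            + zmode Lc (unitS₂ (sfStep Lc j) (smStep d Lc j) (T2RecAt d Lc (toSite r) cE cVH cΛ cE₂ cB Tc vh₂S (mixFFAt (toSite r) Lc) j))
              ν μ (Sum.inl α) (Sum.inl β)) := by
  obtain ⟨CT, δT, hδT, hT⟩ := shape_member hLc hr cE cVH cΛ cE₂ cB Tc hB j
  obtain ⟨C1, δ1, hδ1, hT1⟩ := shape_member hLc hr cE cVH cΛ cE₂ cB Tc hB (j + 1)
  have hTcov := member_translate (r := r) hLc cE cVH cΛ cE₂ cB Tc hBt j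
  obtain ⟨m, CK, hm, hCK, hK⟩ := decays_KInvStep (d := d) (Lc := Lc) j
  have hA := locStencil₂_lin4 (decays_unitK (sf := sfStep Lc j) (sm := smStep d Lc j) hK) (by positivity) hm hLc
    (cE₂ * (Lc : ℝ) ^ (2 * (d + 1))) hT hδT
  have hr0 : 0 < min δ1 (min m δT / 128) := lt_min hδ1 (by positivity)
  rw [zmode_sub (N := N) (hT1.mono (min_le_left _ _)) (hA.mono (min_le_right _ _)) hr0,
    zmode_sub (N := N) (hT1.mono (min_le_left _ _)) (hA.mono (min_le_right _ _)) hr0,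
    zmode_lin4_step hLc N j (cE₂ * (Lc : ℝ) ^ (2 * (d + 1))) hT hδT hTcov μ ν α β,
    zmode_lin4_step hLc N j (cE₂ * (Lc : ℝ) ^ (2 * (d + 1))) hT hδT hTcov ν μ α β]
  ring

/-- NOT IN PRINT; OUR BOOKKEEPING.  **THE CONSERVATION CRITERION** (§3 rearranged): the B-tower's level-`j` source `σ_j = T̃_{j+1} − 𝒜^B_j T̃_j` has
vanishing bond-symmetrised ff charge at `(μ,ν;α,β)` IFF the dressed comb tower obeys road W3's charge law there,
`zmode N T̃_{j+1} (μν) + (νμ) = N^{d+1}·(cE₂·Lc^{2(d+1)})·Lc^{−4(d+2)}·(zmode Lc T̃_j (μν) + (νμ))` (at `N = Lc`, `d = 3`, `cE₂ = Lc⁸` the factor is `1`: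
CHARGE CONSERVATION).  This is the `ZfreeSym` row road W3's END (`TransportRows.transport_rows_three_symZ`) consumes for the hybrid tower in its
(B-above) form — (F2) «of record» after leaf-02 g52's F-leaf02-g52-1 (ii). -/
theorem zfreeSym_sourceB_iff (hLc : 1 ≤ Lc) (hr : r ∈ box (d + 1) Lc) (cE cVH cΛ cE₂ cB : ℝ) (Tc : Fin 4 → Fin 4 → Fin 4 → Fin 4 → ℝ)
    {vh₂S : Tab d} (hB : ∃ C δ : ℝ, 0 < δ ∧ LocStencil₂ vh₂S C δ)
    (hBt : ∀ (κ : Fin (d + 1)) (u : Fin (d + 1) → ℤ) (κ' : Fin (d + 1)) (u' t : Fin (d + 1) → ℤ),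
      vh₂S κ (u + (Lc : ℤ) • t) κ' (u' + (Lc : ℤ) • t) = shiftK (-((Lc : ℤ) • t)) (vh₂S κ u κ' u'))
    (N j : ℕ) (μ ν α β : Fin (d + 1)) :
    (zmode N (fun κ u κ' u' =>
          unitS₂ (sfStep Lc (j + 1)) (smStep d Lc (j + 1)) (T2RecAt d Lc (toSite r) cE cVH cΛ cE₂ cB Tc vh₂S (mixFFAt (toSite r) Lc) (j + 1)) κ u κ' u'
        - lin4 (cE₂ * (Lc : ℝ) ^ (2 * (d + 1))) (unitK (sfStep Lc j) (smStep d Lc j) (KInvStep (d := d) Lc j)) Lc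
            (unitS₂ (sfStep Lc j) (smStep d Lc j) (T2RecAt d Lc (toSite r) cE cVH cΛ cE₂ cB Tc vh₂S (mixFFAt (toSite r) Lc) j)) κ u κ' u')
          μ ν (Sum.inl α) (Sum.inl β)
      + zmode N (fun κ u κ' u' =>
          unitS₂ (sfStep Lc (j + 1)) (smStep d Lc (j + 1)) (T2RecAt d Lc (toSite r) cE cVH cΛ cE₂ cB Tc vh₂S (mixFFAt (toSite r) Lc) (j + 1)) κ u κ' u'
        - lin4 (cE₂ * (Lc : ℝ) ^ (2 * (d + 1))) (unitK (sfStep Lc j) (smStep d Lc j) (KInvStep (d := d) Lc j)) Lc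
            (unitS₂ (sfStep Lc j) (smStep d Lc j) (T2RecAt d Lc (toSite r) cE cVH cΛ cE₂ cB Tc vh₂S (mixFFAt (toSite r) Lc) j)) κ u κ' u')
          ν μ (Sum.inl α) (Sum.inl β) = 0)
    ↔ zmode N (unitS₂ (sfStep Lc (j + 1)) (smStep d Lc (j + 1)) (T2RecAt d Lc (toSite r) cE cVH cΛ cE₂ cB Tc vh₂S (mixFFAt (toSite r) Lc) (j + 1)))
            μ ν (Sum.inl α) (Sum.inl β)
          + zmode N (unitS₂ (sfStep Lc (j + 1)) (smStep d Lc (j + 1)) (T2RecAt d Lc (toSite r) cE cVH cΛ cE₂ cB Tc vh₂S (mixFFAt (toSite r) Lc) (j + 1)))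
            ν μ (Sum.inl α) (Sum.inl β)
        = ((N : ℝ) ^ (d + 1)) * ((cE₂ * (Lc : ℝ) ^ (2 * (d + 1))) * (((Lc : ℝ) ^ (d + 1 + 1))⁻¹) ^ 4) *
          (zmode Lc (unitS₂ (sfStep Lc j) (smStep d Lc j) (T2RecAt d Lc (toSite r) cE cVH cΛ cE₂ cB Tc vh₂S (mixFFAt (toSite r) Lc) j))
              μ ν (Sum.inl α) (Sum.inl β)
            + zmode Lc (unitS₂ (sfStep Lc j) (smStep d Lc j) (T2RecAt d Lc (toSite r) cE cVH cΛ cE₂ cB Tc vh₂S (mixFFAt (toSite r) Lc) j))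
              ν μ (Sum.inl α) (Sum.inl β)) := by
  rw [zmodeSym_sourceB_eq hLc hr cE cVH cΛ cE₂ cB Tc hB hBt N j μ ν α β, sub_eq_zero]

/-! ## §4 Member `0`: the charge of the Wilson part -/

/-- [folklore] The field–field entries of the normalised comb member `0` are `cE₂ ·` those of an3's Wilson bi-stencil (`T2RecAt_zero_level`; units
`Lc^0 = 1`; the generic border's field–field block vanishes by (ShB₂) `hBff`). -/
theorem member_zero_inl_inl (cE cVH cΛ cE₂ cB : ℝ) (Tc : Fin 4 → Fin 4 → Fin 4 → Fin 4 → ℝ) (ρ : Fin (d + 1) → ℤ) {vh₂S mixFF : Tab d}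
    (hBff : ∀ κ u κ' u' x z (α β : Fin (d + 1)), vh₂S κ u κ' u' x z (Sum.inl α) (Sum.inl β) = 0)
    (κ : Fin (d + 1)) (u : Fin (d + 1) → ℤ) (κ' : Fin (d + 1)) (u' x z : Fin (d + 1) → ℤ) (α β : Fin (d + 1)) :
    unitS₂ (sfStep Lc 0) (smStep d Lc 0) (T2RecAt d Lc ρ cE cVH cΛ cE₂ cB Tc vh₂S mixFF 0) κ u κ' u' x z (Sum.inl α) (Sum.inl β)
      = cE₂ * wilsonW₂ d Tc κ u κ' u' x z (Sum.inl α) (Sum.inl β) := by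
  rw [unitS₂_apply, T2RecAt_zero_level]
  simp only [sfStep, smStep, pow_zero, zero_mul, inv_one, one_mul, mul_one, legScale_inl, Pi.add_apply, Pi.smul_apply, smul_eq_mul,
    hBff, mul_zero, add_zero]

/-- [folklore] **THE FIELD–FIELD CHARGE OF MEMBER `0` OF THE COMB TOWER** at any period `N` (any root `ρ`, any off-diagonal border, any mixed table):
`zmode N T̃₀ (μ,ν;α,β) = cE₂ · N^{d+1} · Z₄(Tc)(μ,ν;α,β)`, `Z₄(Tc)(μ,ν;α,β) := Σ'_{u′xz} wilsonW₂ d Tc μ 0 ν u′ x z (inl α) (inl β)` — leaf-18's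
`ChargeStepSymRoot.zmode_member_zero` at the comb family (same Wilson table, first-bond-free by `WilsonQuarticCharge.tsum_wilsonW₂_ff_eq`). -/
theorem zmode_member_zero (N : ℕ) (cE cVH cΛ cE₂ cB : ℝ) (Tc : Fin 4 → Fin 4 → Fin 4 → Fin 4 → ℝ) (ρ : Fin (d + 1) → ℤ) {vh₂S mixFF : Tab d}
    (hBff : ∀ κ u κ' u' x z (α β : Fin (d + 1)), vh₂S κ u κ' u' x z (Sum.inl α) (Sum.inl β) = 0) (μ ν α β : Fin (d + 1)) :
    zmode N (unitS₂ (sfStep Lc 0) (smStep d Lc 0) (T2RecAt d Lc ρ cE cVH cΛ cE₂ cB Tc vh₂S mixFF 0)) μ ν (Sum.inl α) (Sum.inl β)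
      = cE₂ * (((N : ℝ) ^ (d + 1)) *
          ∑' u' : Fin (d + 1) → ℤ, ∑' x : Fin (d + 1) → ℤ, ∑' z : Fin (d + 1) → ℤ,
            wilsonW₂ d Tc μ 0 ν u' x z (Sum.inl α) (Sum.inl β)) := by
  unfold zmode
  simp_rw [member_zero_inl_inl cE cVH cΛ cE₂ cB Tc ρ hBff, tsum_mul_left]
  rw [← Finset.mul_sum]
  congr 1
  rw [Finset.sum_congr rfl fun r _ => (by rw [tsum_wilsonW₂_ff_eq, tsum_wilsonW₂_ff_eq] :
      (∑' u' : Fin (d + 1) → ℤ, ∑' x : Fin (d + 1) → ℤ, ∑' z : Fin (d + 1) → ℤ,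
          wilsonW₂ d Tc μ (toSite r) ν u' x z (Sum.inl α) (Sum.inl β))
        = ∑' u' : Fin (d + 1) → ℤ, ∑' x : Fin (d + 1) → ℤ, ∑' z : Fin (d + 1) → ℤ,
          wilsonW₂ d Tc μ 0 ν u' x z (Sum.inl α) (Sum.inl β)),
    Finset.sum_const, card_box_succ, nsmul_eq_mul]
  push_cast
  ring

end Summit.QuantumFields.BalabanUV.Beta.GAN24.T2RecChargeStep

end
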